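import Literature.Analysis.OperatorTheory.JointEigenbasis
import HarnessLib

/-!
# Uniqueness of positive `r`-th roots among commuting compact self-adjoint operators

Topic `Literature/Analysis/OperatorTheory` (next to `JointEigenbasis.lean`, `CompactSelfAdjointEigenbasis.lean`);
namespace `Literature.Analysis.OperatorTheory`. Theorems only; no definition, no named fact.

On a real Hilbert space `E` let `S`, `T` be compact self-adjoint operators which are positive
(`0 ≤ ⟪S v, v⟫`, `0 ≤ ⟪T v, v⟫`) and commute. If `S ^ r = T ^ r` for some `r ≥ 1`, then `S = T`
(`eq_of_pow_eq_of_nonneg`). Proof: by the tree's spectral theorem for commuting families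
(`JointSpectral.orthogonal_iSup_jointEigenspace_eq_bot`) the joint eigenspaces `J_(σ,τ) = ker(S − σ) ⊓ ker(T − τ)`
span a dense subspace; on a non-zero `v ∈ J_(σ,τ)` one reads off `σ, τ ≥ 0` and `σ ^ r = τ ^ r`, hence `σ = τ`
(`pow_left_injective` on the non-negative reals), i.e. `S v = T v`; two bounded operators agreeing on a dense
subspace agree. This is the operator-theoretic form of "a positive (semi-definite) compact operator has a unique
positive compact `r`-th root commuting with it" (Reed–Simon I, Thm. VI.9 and problem VI.13 for the square root;
Riesz–Sz.-Nagy §104); here it serves the injectivity of Migdal's recursion on Gibbs factors of positive type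
(`MathematicalPhysics/QuantumFieldTheory/MullerSchiemann1987/MS87MigdalInjective.lean`).

## References
* M. Reed, B. Simon, *Methods of Modern Mathematical Physics I: Functional Analysis* (1980), Thm. VI.9 (uniqueness
  of the positive square root), Thm. VI.16 (Hilbert–Schmidt). [ReedSimonI1980]
-/

noncomputable section

namespace Literature.Analysis.OperatorTheory

open Module Module.End Submodule
open scoped InnerProductSpace

variable {E : Type*} [NormedAddCommGroup E] [InnerProductSpace ℝ E]

/-- The eigenvalue of a positive operator at a non-zero eigenvector is non-negative:
`S v = σ v`, `v ≠ 0`, `0 ≤ ⟪S v, v⟫` give `0 ≤ σ`. [folklore] -/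
private theorem eigenvalue_nonneg_of_inner_nonneg {S : E →L[ℝ] E} (hS : ∀ v, 0 ≤ ⟪S v, v⟫_ℝ) {σ : ℝ} {v : E}
    (hv : v ≠ 0) (h : S v = σ • v) : 0 ≤ σ := by
  have h1 := hS v
  rw [h, real_inner_smul_left, real_inner_self_eq_norm_sq] at h1
  have h2 : 0 < ‖v‖ ^ 2 := by positivity
  exact nonneg_of_mul_nonneg_left h1 h2

/-- Powers of an operator act on an eigenvector by powers of the eigenvalue. [folklore] -/
private theorem pow_apply_of_eigen {S : E →L[ℝ] E} {σ : ℝ} {v : E} (h : S v = σ • v) (r : ℕ) :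
    (S ^ r) v = σ ^ r • v := by
  induction r with
  | zero => simp
  | succ r ih =>
      rw [pow_succ]
      change (S ^ r) (S v) = _
      rw [h, map_smul, ih, smul_smul, ← pow_succ']

variable [CompleteSpace E]

/-- **Uniqueness of positive `r`-th roots among commuting compact self-adjoint operators.** On a real Hilbert space,
if `S` and `T` are compact, self-adjoint, positive (`0 ≤ ⟪S v, v⟫`, `0 ≤ ⟪T v, v⟫`), commute, and `S ^ r = T ^ r`
for some `r ≥ 1`, then `S = T`: on each joint eigenspace `S = σ`, `T = τ` with `σ, τ ≥ 0`, `σ ^ r = τ ^ r`, so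
`σ = τ`; the joint eigenspaces span a dense subspace (`JointSpectral.orthogonal_iSup_jointEigenspace_eq_bot`).
[cite: ReedSimonI1980, Thm. VI.9 (uniqueness of the positive square root); folklore for `r`-th roots] -/
theorem eq_of_pow_eq_of_nonneg {S T : E →L[ℝ] E} (hSc : IsCompactOperator S) (hTc : IsCompactOperator T)
    (hSa : IsSelfAdjoint S) (hTa : IsSelfAdjoint T) (hS : ∀ v, 0 ≤ ⟪S v, v⟫_ℝ) (hT : ∀ v, 0 ≤ ⟪T v, v⟫_ℝ)
    (hcomm : Commute S T) {r : ℕ} (hr : r ≠ 0) (hpow : S ^ r = T ^ r) : S = T := by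
  -- the commuting pair as a family indexed by `Bool`
  let F : Bool → E →L[ℝ] E := fun b => if b then S else T
  have hFa : ∀ b, IsSelfAdjoint (F b) := fun b => by cases b <;> simpa [F] using ‹_›
  have hFc : ∀ b, IsCompactOperator (F b) := fun b => by cases b <;> simpa [F]
  have hFcomm : ∀ b b', Commute (F b) (F b') := by
    intro b b'
    cases b <;> cases b' <;> simp [F, hcomm, hcomm.symm]
  have hdense := JointSpectral.orthogonal_iSup_jointEigenspace_eq_bot F hFa hFc hFcomm
  -- `S = T` on each joint eigenspace
  have hJ : ∀ α : Bool → ℝ, ∀ v ∈ JointSpectral.jointEigenspace F α, S v = T v := by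
    intro α v hv
    rw [JointSpectral.mem_jointEigenspace_iff] at hv
    have hSv : S v = α true • v := by simpa [F] using hv true
    have hTv : T v = α false • v := by simpa [F] using hv false
    by_cases hv0 : v = 0
    · simp [hv0]
    have hσ : 0 ≤ α true := eigenvalue_nonneg_of_inner_nonneg hS hv0 hSv
    have hτ : 0 ≤ α false := eigenvalue_nonneg_of_inner_nonneg hT hv0 hTv
    have h1 : (S ^ r) v = (T ^ r) v := by rw [hpow]
    rw [pow_apply_of_eigen hSv, pow_apply_of_eigen hTv] at h1
    have h2 : α true ^ r = α false ^ r := by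
      have h3 : (α true ^ r - α false ^ r) • v = 0 := by rw [sub_smul, h1, sub_self]
      exact sub_eq_zero.mp ((smul_eq_zero.mp h3).resolve_right hv0)
    have h4 : α true = α false := (pow_left_inj₀ hσ hτ hr).mp h2
    rw [hSv, hTv, h4]
  -- hence on their (dense) sup
  have hsup : ∀ v ∈ ⨆ α : Bool → ℝ, JointSpectral.jointEigenspace F α, S v = T v := by
    intro v hv
    refine Submodule.iSup_induction _ hv (motive := fun v => S v = T v) (fun α x hx => hJ α x hx)
      (by simp) (fun a b ha hb => by rw [map_add, map_add, ha, hb])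
  have hd : Dense ((⨆ α : Bool → ℝ, JointSpectral.jointEigenspace F α : Submodule ℝ E) : Set E) :=
    Submodule.dense_iff_topologicalClosure_eq_top.mpr (Submodule.topologicalClosure_eq_top_iff.mpr hdense)
  exact ContinuousLinearMap.coeFn_injective (Continuous.ext_on hd S.continuous T.continuous fun v hv => hsup v hv)

end Literature.Analysis.OperatorTheory
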